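import Literature.AlgebraicGeometry.Motives.MixedHodgeStructureSocleHodgeClasses
import Literature.AlgebraicGeometry.Motives.MixedHodgeStructureLoewySeries
import Literature.AlgebraicGeometry.Motives.MixedHodgeExtensionSplitOverQ
import HarnessLib

/-!
# Socle and radical of direct sums and of extensions of mixed Hodge structures

In the abelian category of MHS (Cattani–El Zein–Griffiths–Lê, *Hodge Theory*, Thm. 3.2.18; semisimple objects
p. 270) socle and radical commute with direct sums, and for an extension `0 → B → E → A → 0` (Carlson's
`Ext(A, B)`, the tree's `MixedHodgeStructure.Extension A B`) with **semisimple ends** one has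
`rad E ⊆ i(B) ⊆ soc E` (so `E` has Loewy length `≤ 2`), with `E` split iff `rad E = 0` iff `soc E = E`
(separated graded-polarizable case, where "split ⇔ semisimple" is the tree's `Extension.isSemisimple_iff_isSplit`,
after CEGL Lemma 8.4.10 / footnote 2 p. 527: the `ℚ`-split MHS are those with no nontrivial extensions).
For **simple** `A`, `B` a non-split extension is uniserial: `soc E = rad E = i(B)` and `0 ⊂ i(B) ⊂ E` are its
only sub-MHS. Namespace `MixedHodgeStructure`; everything proved, no named facts.

## References

* [CattaniElZeinGriffithsLe2014] E. Cattani et al. (eds.), Hodge Theory (2014), Thm. 3.2.18, p. 270, Lemma 8.4.10,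
  Ch. 12 footnote 2 (p. 527).
* [Carlson1980] J. Carlson, Extensions of mixed Hodge structures (Angers 1979), §2(b).
* [Jannsen1990MixedMotives] U. Jannsen, Mixed Motives and Algebraic K-Theory, LNM 1400 (1990), Thm. 7.9.
-/

noncomputable section

namespace Literature.AlgebraicGeometry.Motives

namespace MixedHodgeStructure

universe u v w

/-! ### §1 Direct sums -/

section Prod

variable {V₁ : Type u} [AddCommGroup V₁] [Module ℚ V₁] [FiniteDimensional ℚ V₁]
variable {V₂ : Type v} [AddCommGroup V₂] [Module ℚ V₂] [FiniteDimensional ℚ V₂]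
variable (H₁ : MixedHodgeStructure V₁) (H₂ : MixedHodgeStructure V₂)

omit [FiniteDimensional ℚ V₁] [FiniteDimensional ℚ V₂] in
/-- `(a, b) = ι₁ a + ι₂ b`. [cite: CattaniElZeinGriffithsLe2014, Thm. 3.2.18] -/
private theorem inl_add_inr (a : V₁) (b : V₂) :
    (Hom.inl H₁ H₂).toLinearMap a + (Hom.inr H₁ H₂).toLinearMap b = (a, b) := by
  rw [Hom.inl_toLinearMap, Hom.inr_toLinearMap, LinearMap.inl_apply, LinearMap.inr_apply, Prod.mk_add_mk, add_zero,
    zero_add]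

/-- **`soc(H₁ ⊕ H₂) = soc H₁ ⊕ soc H₂`.** [cite: CattaniElZeinGriffithsLe2014, Thm. 3.2.18 and p. 270] -/
theorem socle_prod : (socle (H₁.prod H₂)).toSubmodule = (socle H₁).toSubmodule.prod (socle H₂).toSubmodule := by
  refine le_antisymm (fun x hx => ?_) ?_
  · exact ⟨(Hom.fst H₁ H₂).apply_mem_socle hx, (Hom.snd H₁ H₂).apply_mem_socle hx⟩
  · rintro ⟨a, b⟩ ⟨ha, hb⟩
    rw [← inl_add_inr H₁ H₂ a b]
    exact Submodule.add_mem _ ((Hom.inl H₁ H₂).apply_mem_socle ha) ((Hom.inr H₁ H₂).apply_mem_socle hb)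

/-- **`rad(H₁ ⊕ H₂) = rad H₁ ⊕ rad H₂`.** [cite: CattaniElZeinGriffithsLe2014, Thm. 3.2.18 and p. 270] -/
theorem radical_prod :
    (radical (H₁.prod H₂)).toSubmodule = (radical H₁).toSubmodule.prod (radical H₂).toSubmodule := by
  refine le_antisymm (fun x hx => ?_) ?_
  · exact ⟨(Hom.fst H₁ H₂).apply_mem_radical hx, (Hom.snd H₁ H₂).apply_mem_radical hx⟩
  · rintro ⟨a, b⟩ ⟨ha, hb⟩
    rw [← inl_add_inr H₁ H₂ a b]
    exact Submodule.add_mem _ ((Hom.inl H₁ H₂).apply_mem_radical ha) ((Hom.inr H₁ H₂).apply_mem_radical hb)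

/-- `H₁ ⊕ H₂` is semisimple iff both summands are. [cite: CattaniElZeinGriffithsLe2014, Thm. 3.2.18 and p. 270] -/
theorem isSemisimple_prod_iff : (H₁.prod H₂).IsSemisimple ↔ H₁.IsSemisimple ∧ H₂.IsSemisimple :=
  ⟨fun h => ⟨h.of_surjective (Hom.fst H₁ H₂) fun a => ⟨(a, 0), rfl⟩, h.of_surjective (Hom.snd H₁ H₂) fun b => ⟨(0, b), rfl⟩⟩,
    fun h => h.1.prod h.2⟩

end Prod

/-! ### §2 Extensions with semisimple ends -/

namespace Extension

variable {VA : Type u} [AddCommGroup VA] [Module ℚ VA] [FiniteDimensional ℚ VA]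
variable {VB : Type v} [AddCommGroup VB] [Module ℚ VB] [FiniteDimensional ℚ VB]
variable {VE : Type w} [AddCommGroup VE] [Module ℚ VE] [FiniteDimensional ℚ VE]
variable {A : MixedHodgeStructure VA} {B : MixedHodgeStructure VB} (E : Extension A B VE)

omit [FiniteDimensional ℚ VA] in
/-- **`i(B) ⊆ soc E` when `B` is semisimple.** [cite: CattaniElZeinGriffithsLe2014, Thm. 3.2.18 and p. 270] -/
theorem range_inc_le_socle (hB : B.IsSemisimple) : LinearMap.range E.inc.toLinearMap ≤ (socle E.mhs).toSubmodule :=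
  hB.range_le_socle E.inc

omit [FiniteDimensional ℚ VA] [FiniteDimensional ℚ VB] in
/-- **`rad E ⊆ i(B)` when `A` is semisimple** (`E / i(B) ≅ A`). [cite: CattaniElZeinGriffithsLe2014, Thm. 3.2.18 and p. 270] -/
theorem radical_le_range_inc (hA : A.IsSemisimple) :
    (radical E.mhs).toSubmodule ≤ LinearMap.range E.inc.toLinearMap := by
  rw [E.range_inc]
  exact hA.radical_le_ker E.proj

omit [FiniteDimensional ℚ VA] in
/-- **`rad E ⊆ soc E` for an extension with semisimple ends** (Loewy length `≤ 2`).
[cite: CattaniElZeinGriffithsLe2014, Thm. 3.2.18 and p. 270] -/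
theorem radical_le_socle (hA : A.IsSemisimple) (hB : B.IsSemisimple) :
    (radical E.mhs).toSubmodule ≤ (socle E.mhs).toSubmodule :=
  (E.radical_le_range_inc hA).trans (E.range_inc_le_socle hB)

omit [FiniteDimensional ℚ VA] in
/-- The radical of an extension with semisimple ends is semisimple. [cite: CattaniElZeinGriffithsLe2014, p. 270] -/
theorem isSemisimple_radical (hA : A.IsSemisimple) (hB : B.IsSemisimple) :
    (radical E.mhs).toMixedHodgeStructure.IsSemisimple :=
  isSemisimple_of_le_socle _ (E.radical_le_socle hA hB)

omit [FiniteDimensional ℚ VA] in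
/-- `E / soc E` is semisimple for an extension with semisimple ends. [cite: CattaniElZeinGriffithsLe2014, p. 270] -/
theorem isSemisimple_socle_quotient (hA : A.IsSemisimple) (hB : B.IsSemisimple) :
    (socle E.mhs).quotient.IsSemisimple :=
  (isSemisimple_quotient_iff_radical_le _).2 (E.radical_le_socle hA hB)

omit [FiniteDimensional ℚ VA] in
/-- `soc² E = E` for an extension with semisimple ends. [cite: CattaniElZeinGriffithsLe2014, p. 270] -/
theorem socleSeries_two_eq_top (hA : A.IsSemisimple) (hB : B.IsSemisimple) : (socleSeries E.mhs 2).toSubmodule = ⊤ :=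
  socleSeries_succ_eq_top_of_isSemisimple E.mhs 1 (by rw [socleSeries_one]; exact E.isSemisimple_socle_quotient hA hB)

omit [FiniteDimensional ℚ VA] in
/-- `rad² E = 0` for an extension with semisimple ends. [cite: CattaniElZeinGriffithsLe2014, p. 270] -/
theorem radicalSeries_two_eq_bot (hA : A.IsSemisimple) (hB : B.IsSemisimple) :
    (radicalSeries E.mhs 2).toSubmodule = ⊥ :=
  radicalSeries_succ_eq_bot_of_isSemisimple E.mhs 1 (by rw [radicalSeries_one]; exact E.isSemisimple_radical hA hB)

/-- **A separated extension of semisimple graded-polarizable MHS splits iff `rad E = 0`.**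
[cite: CattaniElZeinGriffithsLe2014, Lemma 8.4.10 and Ch. 12 footnote 2 (p. 527)] [cite: Carlson1980, §2(b)] -/
theorem isSplit_iff_radical_eq_bot (hsep : IsSeparated A B) (hpA : A.IsGradedPolarizable) (hpB : B.IsGradedPolarizable)
    (hA : A.IsSemisimple) (hB : B.IsSemisimple) : E.IsSplit ↔ (radical E.mhs).toSubmodule = ⊥ := by
  rw [radical_eq_bot_iff, E.isSemisimple_iff_isSplit hsep hpA hpB]
  exact ⟨fun h => ⟨h, hA, hB⟩, fun h => h.1⟩

/-- … iff `soc E = E`. [cite: CattaniElZeinGriffithsLe2014, Lemma 8.4.10 and Ch. 12 footnote 2 (p. 527)] [cite: Carlson1980, §2(b)] -/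
theorem isSplit_iff_socle_eq_top (hsep : IsSeparated A B) (hpA : A.IsGradedPolarizable) (hpB : B.IsGradedPolarizable)
    (hA : A.IsSemisimple) (hB : B.IsSemisimple) : E.IsSplit ↔ (socle E.mhs).toSubmodule = ⊤ := by
  rw [socle_eq_top_iff, E.isSemisimple_iff_isSplit hsep hpA hpB]
  exact ⟨fun h => ⟨h, hA, hB⟩, fun h => h.1⟩

/-- Pure polarizable ends of weights `b < a`: `E` splits iff `rad E = 0`. [cite: CattaniElZeinGriffithsLe2014, Lemma 8.4.10]
[cite: Jannsen1990MixedMotives, Thm. 7.9 (proof)] -/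
theorem isSplit_iff_radical_eq_bot_of_pure {a b : ℤ} {A' : HodgeStructure VA a} {B' : HodgeStructure VB b}
    (E' : Extension A'.toMixedHodgeStructure B'.toMixedHodgeStructure VE) (hab : b < a) (hpA : A'.IsPolarizable)
    (hpB : B'.IsPolarizable) : E'.IsSplit ↔ (radical E'.mhs).toSubmodule = ⊥ := by
  rw [radical_eq_bot_iff, E'.isSemisimple_iff_isSplit_of_pure hab hpA hpB]

/-! ### §3 Simple ends: non-split extensions are uniserial -/

omit [FiniteDimensional ℚ VA] [FiniteDimensional ℚ VB] [FiniteDimensional ℚ VE] in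
/-- For simple `A`, a sub-MHS of `E` containing `i(B)` is `i(B)` or `E` (`E / i(B) ≅ A`).
[cite: CattaniElZeinGriffithsLe2014, Thm. 3.2.18 and p. 270] -/
theorem eq_range_inc_or_eq_top_of_isSimple (hA : A.IsSimple) (T : SubMixedHodgeStructure E.mhs)
    (hT : LinearMap.range E.inc.toLinearMap ≤ T.toSubmodule) :
    T.toSubmodule = LinearMap.range E.inc.toLinearMap ∨ T.toSubmodule = ⊤ := by
  rcases hA.eq_bot_or_eq_top (T.map E.proj) with h | h
  · refine Or.inl (le_antisymm (fun x hx => ?_) hT)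
    rw [E.range_inc, LinearMap.mem_ker]
    have hx' : E.proj.toLinearMap x ∈ (T.map E.proj).toSubmodule := ⟨x, hx, rfl⟩
    rw [h] at hx'
    exact (Submodule.mem_bot ℚ).1 hx'
  · refine Or.inr (eq_top_iff.2 fun x _ => ?_)
    have hx : E.proj.toLinearMap x ∈ (T.map E.proj).toSubmodule := by rw [h]; exact Submodule.mem_top
    obtain ⟨t, ht, htx⟩ := hx
    have hxt : x - t ∈ T.toSubmodule := hT (by rw [E.range_inc, LinearMap.mem_ker, map_sub, htx, sub_self])
    have hsum := T.toSubmodule.add_mem hxt ht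
    rwa [sub_add_cancel] at hsum

omit [FiniteDimensional ℚ VA] [FiniteDimensional ℚ VB] [FiniteDimensional ℚ VE] in
/-- For simple `B`, a sub-MHS of `E` inside `i(B)` is `0` or `i(B)`. [cite: CattaniElZeinGriffithsLe2014, Thm. 3.2.18 and p. 270] -/
theorem eq_bot_or_eq_range_inc_of_isSimple (hB : B.IsSimple) (T : SubMixedHodgeStructure E.mhs)
    (hT : T.toSubmodule ≤ LinearMap.range E.inc.toLinearMap) :
    T.toSubmodule = ⊥ ∨ T.toSubmodule = LinearMap.range E.inc.toLinearMap := by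
  have key : T.toSubmodule = (T.toSubmodule.comap E.inc.toLinearMap).map E.inc.toLinearMap := by
    rw [Submodule.map_comap_eq, inf_eq_right.2 hT]
  rcases hB.eq_bot_or_eq_top (T.comap E.inc) with h | h <;> rw [SubMixedHodgeStructure.comap_toSubmodule] at h
  · left
    rw [key, h, Submodule.map_bot]
  · right
    rw [key, h, Submodule.map_top]

omit [FiniteDimensional ℚ VA] in
/-- **Non-split, `A` simple, `B` semisimple: `soc E = i(B)`.** [cite: CattaniElZeinGriffithsLe2014, Thm. 3.2.18 and p. 270]
[cite: Carlson1980, §2(b)] -/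
theorem socle_eq_range_inc_of_not_isSplit (hA : A.IsSimple) (hB : B.IsSemisimple) (hsep : IsSeparated A B)
    (h : ¬E.IsSplit) : (socle E.mhs).toSubmodule = LinearMap.range E.inc.toLinearMap := by
  rcases E.eq_range_inc_or_eq_top_of_isSimple hA (socle E.mhs) (E.range_inc_le_socle hB) with h' | h'
  · exact h'
  · exact absurd (E.isSplit_of_isSemisimple hsep (socle_eq_top_iff.1 h')) h

omit [FiniteDimensional ℚ VA] [FiniteDimensional ℚ VB] in
/-- **Non-split, `A` semisimple, `B` simple: `rad E = i(B)`.** [cite: CattaniElZeinGriffithsLe2014, Thm. 3.2.18 and p. 270]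
[cite: Carlson1980, §2(b)] -/
theorem radical_eq_range_inc_of_not_isSplit (hA : A.IsSemisimple) (hB : B.IsSimple) (hsep : IsSeparated A B)
    (h : ¬E.IsSplit) : (radical E.mhs).toSubmodule = LinearMap.range E.inc.toLinearMap := by
  rcases E.eq_bot_or_eq_range_inc_of_isSimple hB (radical E.mhs) (E.radical_le_range_inc hA) with h' | h'
  · exact absurd (E.isSplit_of_isSemisimple hsep (radical_eq_bot_iff.1 h')) h
  · exact h'

omit [FiniteDimensional ℚ VA] in
/-- **Non-split extension of simple MHS: `soc E = rad E` (`= i(B)`).** [cite: CattaniElZeinGriffithsLe2014, p. 270]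
[cite: Carlson1980, §2(b)] -/
theorem socle_eq_radical_of_not_isSplit (hA : A.IsSimple) (hB : B.IsSimple) (hsep : IsSeparated A B)
    (h : ¬E.IsSplit) : (socle E.mhs).toSubmodule = (radical E.mhs).toSubmodule := by
  rw [E.socle_eq_range_inc_of_not_isSplit hA hB.isSemisimple hsep h,
    E.radical_eq_range_inc_of_not_isSplit hA.isSemisimple hB hsep h]

omit [FiniteDimensional ℚ VA] [FiniteDimensional ℚ VB] [FiniteDimensional ℚ VE] in
/-- **A non-split extension of simple MHS is uniserial: its sub-MHS are `0`, `i(B)`, `E`.** (A sub-MHS `T` with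
`T ∩ i(B) = 0` and `π(T) = A` would be a complement of `i(B)`, splitting `E`.)
[cite: CattaniElZeinGriffithsLe2014, Thm. 3.2.18 and p. 270] [cite: Carlson1980, §2(b)] -/
theorem eq_bot_or_eq_range_inc_or_eq_top_of_not_isSplit (hA : A.IsSimple) (hB : B.IsSimple) (h : ¬E.IsSplit)
    (T : SubMixedHodgeStructure E.mhs) :
    T.toSubmodule = ⊥ ∨ T.toSubmodule = LinearMap.range E.inc.toLinearMap ∨ T.toSubmodule = ⊤ := by
  rcases hB.eq_bot_or_eq_top (T.comap E.inc) with hc | hc <;> rw [SubMixedHodgeStructure.comap_toSubmodule] at hc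
  · -- `T ∩ i(B) = 0`
    have hdis : Disjoint (LinearMap.range E.inc.toLinearMap) T.toSubmodule := by
      rw [disjoint_iff, eq_bot_iff]
      rintro _ ⟨⟨b, rfl⟩, hxT⟩
      have hb : b ∈ T.toSubmodule.comap E.inc.toLinearMap := hxT
      rw [hc, Submodule.mem_bot] at hb
      rw [hb, map_zero]
      exact Submodule.zero_mem _
    rcases hA.eq_bot_or_eq_top (T.map E.proj) with hm | hm
    · refine Or.inl (eq_bot_iff.2 fun x hx => ?_)
      have hx' : x ∈ LinearMap.range E.inc.toLinearMap := by
        rw [E.range_inc, LinearMap.mem_ker]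
        have hpx : E.proj.toLinearMap x ∈ (T.map E.proj).toSubmodule := ⟨x, hx, rfl⟩
        rw [hm] at hpx
        exact (Submodule.mem_bot ℚ).1 hpx
      exact hdis.le_bot ⟨hx', hx⟩
    · -- `π(T) = A`: `T` is a complement of `i(B)`, so `E` splits
      refine absurd (E.isSplit_of_isCompl_range_inc T ⟨hdis, codisjoint_iff.2 (eq_top_iff.2 fun x _ => ?_)⟩) h
      have hx : E.proj.toLinearMap x ∈ (T.map E.proj).toSubmodule := by rw [hm]; exact Submodule.mem_top
      obtain ⟨t, ht, htx⟩ := hx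
      have hxt : x - t ∈ LinearMap.range E.inc.toLinearMap := by
        rw [E.range_inc, LinearMap.mem_ker, map_sub, htx, sub_self]
      exact Submodule.mem_sup.2 ⟨x - t, hxt, t, ht, sub_add_cancel x t⟩
  · -- `i(B) ⊆ T`
    have hT : LinearMap.range E.inc.toLinearMap ≤ T.toSubmodule := by
      rintro _ ⟨b, rfl⟩
      have hb : b ∈ T.toSubmodule.comap E.inc.toLinearMap := by rw [hc]; exact Submodule.mem_top
      exact hb
    exact Or.inr (E.eq_range_inc_or_eq_top_of_isSimple hA T hT)

end Extension

end MixedHodgeStructure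

end Literature.AlgebraicGeometry.Motives
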